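import Literature.IUT.HodgeArakelov.RadialEnvironments
import Literature.IUT.HodgeArakelov.RadialExamples
import Literature.IUT.HodgeArakelov.RadialGraphs
import Literature.IUT.HodgeArakelov.AbsTopInterfaces
import Literature.IUT.HodgeArakelov.GaloisPairRigidity

/-!
# [IUTchII] §1, Remark 1.11.3 (i), (iii), (v): named reading anchors (Cor. 3.12 pins)

Mochizuki, *Inter-universal Teichmüller theory II*, §1, Remark 1.11.3, kurims manuscript (Dec. 2020)
pp. 51–54 [claim: Mochizuki2012, status: disputed] (IUTchII §1 Rmk 1.11.3, kurims pp.51-54). Record-only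
typing under the claim key `Mochizuki2012` (D-0012, disputed).

The landed `GaloisPairRigidity.lean` (p409065, frozen) records `IUTchII:Rmk1.11.3(i)`, `(iii)`, `(v)` as
"expository, noted" in its module docstring. These three sub-items are PINS of the [IUTchIII] Cor. 3.12 proof
(plan/L6/COR312-PINS), cited by declaration name; abc-iut-L6-lead 2026-08-25T22:21:04Z asked for NAMED
anchors "stating the printed sentence's checkable content where there is one". This companion file supplies
them, over the landed vocabulary (`RadialEnvironment`, `Functor.Graph`, `AbsTopMonoids`,
`GaloisPairRigidityData.orbitA/orbitB`); nothing of p409065 is restated or changed.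

* `IUTchII:Rmk1.11.3(i)` (pp. 51–52) — "if one takes `G` to be a part of one's coric data, then any objects
  constructed group-theoretically from `G` may also be regarded naturally as constituting a portion of the
  coric data — so long as one regards these objects as being equipped with the corresponding anabelian
  structures [i.e., the data that specifies the way in which they were constructed group-theoretically from
  `G`]. … once one forgets these anabelian structures, it is no longer the case …; it is necessary to specify
  explicitly that such an object is to be regarded as a portion of the coric data". CHECKABLE CONTENT in the
  formalism of Ex. 1.7/1.9: adjoining to the coric category `𝒞` the graph of a functor `Ξ : 𝒞 → 𝒟` (the
  constructed object WITH its construction = "anabelian structure", Ex. 1.9 (i)) yields a radial environment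
  `adjoinCoric` which is multiradial iff the original one is — DEFINED + PROVED (`Rmk1113_i_reading`);
  forgetting the construction (passing to `𝒟` along `Φ ⋙ Ξ`) is NOT covered by this — cf. the non-full
  quotient functor `quotientFunctor_not_full` of `RadialGraphs` (Ex. 1.9 (iii)).
* `IUTchII:Rmk1.11.3(iii)` (pp. 52–53) — "(a) the indeterminacies — i.e., 'orbits' — that appear in Corollary
  1.11, (a), (b), are a consequence of the highly nontrivial relationship … between the input data `O^⊳(−)` of
  the cyclotomic rigidity algorithm involved and the coric data `O^{×μ}(−)`. By contrast, (b) the 'strict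
  cyclotomic rigidity' asserted in Corollary 1.10 is a consequence … of the triviality of the homomorphism that
  relates the cyclotomic portion of `O^⊳(−)` — which is the only portion of `O^⊳(−)` that appears in a
  mono-theta environment — to the coric data `O^{×μ}(−)`." CHECKABLE CONTENT of (b): the composite
  `O^μ(G) ↪ O^×(G) ↠ O^{×μ}(G)` is the TRIVIAL homomorphism — PROVED over the [AbsTopIII] interface
  (`Rmk1113_iii_reading`); (a) and the closing "existence vs content of reconstruction algorithms" paragraph
  are expository (no separately checkable content; noted here by locator).
* `IUTchII:Rmk1.11.3(v)` (pp. 53–54) — "the exterior cyclotome of the mono-theta environment that appears in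
  Corollary 1.10 and the cyclotome arising from `O^⊳(−)` that appears in Corollary 1.11, (a), both correspond
  to the same cyclotome `μ_N(S)` [Prop. 1.3 — tree: `Prop13_iii`] … in order to relate the exterior cyclotome
  `Π_μ(M^Θ_*(Π))` of Corollary 1.10 to the cyclotome `μ_Ẑ(O^×(G))` of Corollary 1.11, (a), it is necessary
  [cf. Proposition 1.3, (iii)] to pass through the cyclotome `(l·Δ_Θ)(Π)` by applying the cyclotomic rigidity
  isomorphisms of Corollaries 1.10, 1.11 — which, in the case of Corollary 1.11, results in various
  indeterminacies. … [the identification] may be thought of either as being only uniradially defined, or as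
  multiradially defined, but only up to certain indeterminacies." CHECKABLE CONTENT: the comparison
  `Π_μ(M^Θ_*(Π)) ≅ μ_Ẑ(O^×(G))` obtained through `(l·Δ_Θ)(Π)` from a single ("strict", Cor. 1.10) isomorphism
  `Π_μ(M^Θ_*(Π)) ≅ (l·Δ_Θ)(Π)` and the ORBITS `(*bs-Gal_{G,Π})`, `(*bs-Gal_{G,⊳})` of Cor. 1.11 is a SET of
  isomorphisms (`GaloisPairRigidityData.cyclotomeComparison`, DEFINED) which is nonempty and stable under the
  `Γ`-indeterminacy — PROVED (`Rmk1113_v_reading`).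
* `IUTchII:Rmk1.11.1(i)` (a)–(c), AUTHOR-ERRATA note (cell rule G15; abc-iut-L6-t23 finding G15-1,
  2026-08-25T22:16:09Z; docstring-only, no statement change): the landed named facts `Rmk1111_a/_b/_c` cite
  "[AbsTopIII], Proposition 3.2, (iv)" / "3.3, (ii)" as printed in [IUTchII]; the author's *Comments* on
  [AbsTopIII] (Jun 2019), item (5), restate those two results for pairs of hyperbolic-orbicurve (or strictly
  Belyi) type only, so the MONO-ANALYTIC case used in Rmk. 1.11.1 (i) is [IUTchII]'s own assertion (its ground
  being the functoriality of the mono-analytic reconstruction, [AbsTopIII] Cor. 1.10); the [IUTchII] (2020)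
  statement is the current source and is what `Rmk1111_a/_b/_c` type. Recorded here because p409065 is frozen.

Nothing here takes a side on [IUTchIII] Cor. 3.12; typed ≠ discharged.
-/

namespace Literature.IUT.HodgeArakelov

open CategoryTheory

universe v v' u u'

/-! ## Remark 1.11.3 (i): constructed objects WITH their anabelian structure are coric -/

namespace Functor.Graph

variable {E : Type u} [Category.{v} E] {F : Type u'} [Category.{v'} F] (Ξ : E ⥤ F)

/-- `ℰ → 𝒢`, `E ↦ (E, Ξ(E))`, is full (Ex. 1.9 (i): the morphisms of the graph are the pairs `(f, Ξ(f))`).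
[claim: Mochizuki2012, status: disputed] (IUTchII §1 Ex 1.9 (i), kurims p.42) -/
theorem ofBase_full : (ofBase Ξ).Full := ⟨fun g => ⟨g.hom, rfl⟩⟩

/-- `ℰ → 𝒢` is faithful. [claim: Mochizuki2012, status: disputed] (IUTchII §1 Ex 1.9 (i), kurims p.42) -/
theorem ofBase_faithful : (ofBase Ξ).Faithful :=
  ⟨fun {_ _} _ _ h => congrArg InducedCategory.Hom.hom h⟩

/-- `ℰ → 𝒢` is essentially surjective (the identity on objects).
[claim: Mochizuki2012, status: disputed] (IUTchII §1 Ex 1.9 (i), kurims p.42) -/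
theorem ofBase_essSurj : (ofBase Ξ).EssSurj := ⟨fun Y => ⟨Y, ⟨Iso.refl _⟩⟩⟩

end Functor.Graph

/-- **IUTchII:Rmk1.11.3(i)** (kurims pp. 51–52), the construction: ADJOIN to the coric data of a radial
environment `(ℛ, 𝒞, Φ)` an object "constructed group-theoretically from `G`" TOGETHER WITH its anabelian
structure — i.e. replace `𝒞` by the graph `𝒢` of the construction functor `Ξ : 𝒞 → 𝒟` (Ex. 1.9 (i): objects
`(C, Ξ(C))`, morphisms `(f, Ξ(f))`) and `Φ` by `ℛ → 𝒞 → 𝒢` (DEFINED). [claim: Mochizuki2012, status: disputed]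
(IUTchII §1 Rmk 1.11.3 (i), kurims pp.51-52) -/
def RadialEnvironment.adjoinCoric (Env : RadialEnvironment.{v, u}) {D : Type u'} [Category.{v'} D]
    (Ξ : Env.C ⥤ D) : RadialEnvironment.{v, u} where
  R := Env.R
  C := Functor.Graph Ξ
  Φ := Env.Φ ⋙ Functor.Graph.ofBase Ξ
  essSurj := by
    haveI := Functor.Graph.ofBase_essSurj Ξ
    exact inferInstance

/-- **IUTchII:Rmk1.11.3(i)** (kurims pp. 51–52), READING, PROVED: "any objects constructed group-theoretically
from `G` may also be regarded naturally as constituting a portion of the coric data — so long as one regards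
these objects as being equipped with the corresponding anabelian structures": adjoining the graph of the
construction to the coric data changes nothing about multiradiality (the radial environment stays multiradial,
resp. uniradial). The printed caveat "once one forgets these anabelian structures, it is no longer the case"
concerns replacing `𝒞` by the TARGET `𝒟` of `Ξ`, which this statement does not cover (cf.
`quotientFunctor_not_full`). [claim: Mochizuki2012, status: disputed] (IUTchII §1 Rmk 1.11.3 (i), kurims pp.51-52) -/
theorem Rmk1113_i_reading (Env : RadialEnvironment.{v, u}) {D : Type u'} [Category.{v'} D]
    (Ξ : Env.C ⥤ D) : (Env.adjoinCoric Ξ).IsMultiradial ↔ Env.IsMultiradial := by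
  constructor
  · intro h
    -- `Φ ⋙ ofBase` full and `ofBase` faithful ⇒ `Φ` full
    haveI : (Env.Φ ⋙ Functor.Graph.ofBase Ξ).Full := h
    haveI := Functor.Graph.ofBase_faithful Ξ
    exact Functor.Full.of_comp_faithful Env.Φ (Functor.Graph.ofBase Ξ)
  · intro h
    haveI : Env.Φ.Full := h
    haveI := Functor.Graph.ofBase_full Ξ
    exact (inferInstance : (Env.Φ ⋙ Functor.Graph.ofBase Ξ).Full)

/-! ## Remark 1.11.3 (iii): the trivial homomorphism `O^μ(−) → O^{×μ}(−)` -/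

/-- **IUTchII:Rmk1.11.3(iii)** (kurims pp. 52–53), READING of (b), PROVED over the [AbsTopIII] interface: "the
triviality of the homomorphism that relates the cyclotomic portion of `O^⊳(−)` — which is the only portion
of `O^⊳(−)` that appears in a mono-theta environment — to the coric data `O^{×μ}(−)`": the composite
`O^μ(G) ↪ O^×(G) ↠ O^{×μ}(G) = O^×(G)/O^μ(G)` is trivial. ((a) — the orbits of Cor. 1.11 (a), (b) as a
consequence of the nontrivial relationship between `O^⊳(−)` and `O^{×μ}(−)` — and the closing "existence vs
content" paragraph are expository; the Cor. 1.12 incarnation `M^μ_TM(Π) → M^{×μ}_TM(Π)` of this triviality is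
`ThetaEvaluation.mmuTM_to_mxmuTM_eq_zero` of `ConstantMultipleRigidity`.)
[claim: Mochizuki2012, status: disputed] (IUTchII §1 Rmk 1.11.3 (iii), kurims pp.52-53) -/
theorem Rmk1113_iii_reading {S : ThetaSetting.{u}} (A : AbsTopMonoids S) (G : IsoClass S.Gk)
    (x : A.Ounits G) (hx : x ∈ A.Omu G) : (QuotientGroup.mk x : A.Oxmu G) = 1 := by
  rwa [QuotientGroup.eq_one_iff]

/-! ## Remark 1.11.3 (v): relating `Π_μ(M^Θ_*(Π))` to `μ_Ẑ(O^×(G))` through `(l·Δ_Θ)(Π)` -/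

section RmkV

variable {S : ThetaSetting.{u}} {A : AbsTopMonoids S}

/-- **IUTchII:Rmk1.11.3(v)** (kurims pp. 53–54), the construction: "in order to relate the exterior cyclotome
`Π_μ(M^Θ_*(Π))` of Corollary 1.10 to the cyclotome `μ_Ẑ(O^×(G))` of Corollary 1.11, (a), it is necessary … to
pass through the cyclotome `(l·Δ_Θ)(Π)` by applying the cyclotomic rigidity isomorphisms of Corollaries 1.10,
1.11" — the resulting SET of comparison isomorphisms: a single (strict) Cor. 1.10 isomorphism
`r : Π_μ(M^Θ_*(Π)) ≅ (l·Δ_Θ)(Π)` (the exterior cyclotome carried as an abstract group `X`), followed by the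
inverses of the orbit `(*bs-Gal_{G,Π})` (`orbitB`) and by the orbit `(*bs-Gal_{G,⊳})` (`orbitA`) (DEFINED).
[claim: Mochizuki2012, status: disputed] (IUTchII §1 Rmk 1.11.3 (v), kurims pp.53-54) -/
def GaloisPairRigidityData.cyclotomeComparison (D : GaloisPairRigidityData A) (Γ : Subgroup ZHatUnits)
    (P : IsoClass S.PiX) (G : IsoClass S.Gk) {X : Type u} [CommGroup X] (r : X ≃* D.lDeltaTheta P) :
    Set (X ≃* A.muZhatUnits G) :=
  {ψ | ∃ φB ∈ D.orbitB P G, ∃ φA ∈ D.orbitA Γ G, ψ = r.trans (φB.symm.trans φA)}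

/-- **IUTchII:Rmk1.11.3(v)** (kurims pp. 53–54), READING, PROVED: the comparison of `Π_μ(M^Θ_*(Π))` with
`μ_Ẑ(O^×(G))` through `(l·Δ_Θ)(Π)` "results in various indeterminacies", i.e. it is "multiradially defined,
but only up to certain indeterminacies": the comparison set is NONEMPTY (the identification exists) and is
STABLE under the `Γ`-indeterminacy acting on `μ_Ẑ(O^×(G))` through `(*bs-Gal_{G,⊳})` (it is a union of
`Γ`-orbits, not a single isomorphism). [claim: Mochizuki2012, status: disputed] (IUTchII §1 Rmk 1.11.3 (v), kurims pp.53-54) -/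
theorem Rmk1113_v_reading (D : GaloisPairRigidityData A) (Γ : Subgroup ZHatUnits) (P : IsoClass S.PiX)
    (G : IsoClass S.Gk) {X : Type u} [CommGroup X] (r : X ≃* D.lDeltaTheta P) :
    (D.cyclotomeComparison Γ P G r).Nonempty ∧
    ∀ ψ ∈ D.cyclotomeComparison Γ P G r, ∀ γ ∈ Γ,
      ψ.trans ((D.bsGalTri G).symm.trans ((D.twist G γ).trans (D.bsGalTri G))) ∈
        D.cyclotomeComparison Γ P G r := by
  constructor
  · obtain ⟨e⟩ := IsoClass.nonempty_hom G ⟨TopGroup.quot P.G (A.Delta P), A.quotIso P⟩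
    refine ⟨r.trans (((D.mapMu e).trans (D.corPiX P)).symm.trans ((D.twist G 1).trans (D.bsGalTri G))),
      (D.mapMu e).trans (D.corPiX P), ⟨e, rfl⟩, (D.twist G 1).trans (D.bsGalTri G), ⟨1, Γ.one_mem, rfl⟩,
      rfl⟩
  · rintro ψ ⟨φB, hφB, φA, ⟨γ₀, hγ₀, rfl⟩, rfl⟩ γ hγ
    refine ⟨φB, hφB, (D.twist G (γ * γ₀)).trans (D.bsGalTri G), ⟨γ * γ₀, Γ.mul_mem hγ hγ₀, rfl⟩, ?_⟩
    ext x
    simp [MulEquiv.trans_apply, map_mul, MulAut.mul_apply]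

end RmkV

end Literature.IUT.HodgeArakelov
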